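import Literature.Algebra.Homology.TateCohomologyConnectingNegOne
import Literature.Algebra.Homology.TateCohomologyNegTwoClasses
import HarnessLib

/-!
# The connecting map `δ : Ĥ⁻²(G, C) → Ĥ⁻¹(G, A)` of `0 → A → B → C → 0` on classes:
# `δ[z] = [a]` with `f a = ∂b`, `g ∘ b = z` (Serre, *Local Fields* VIII §1 / VII §3;
# Brown VI §5) — on Mathlib's `tateCohomology`

Topic `Algebra/Homology`; namespace `Literature.Algebra.Homology.Tate`.  Imports the lane files
`TateCohomologyConnectingNegOne` (g19-#6: `negOneClass : ker N → Ĥ⁻¹`, `δ₋₁`) and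
`TateCohomologyNegTwoClasses` (g19-#7: `negTwoClass : Z₁(G, M) → Ĥ⁻²`), and Mathlib's element-level
snake lemma `ShortComplex.ShortExact.δ_apply`; theorems only; NO named fact, no `sorry`.  Lane
`lit-hodgefound` (Track 2 foundations library), seat p30 gen 19, row g19-#8 of
`run/shared/lean/pub/lit-hodgefound/SKELETON.md`.

Source followed.  J.-P. Serre, *Local Fields*, GTM 67 (1979), VIII §1 [held copy
`book:serre1979-local-fields`, chunk p0117]: for `0 → A → B → C → 0` exact, the Tate groups form
one long exact sequence "`… → Ĥ⁻²(G, C) --δ--> Ĥ⁻¹(G, A) → Ĥ⁻¹(G, B) → …`", which in degrees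
`≤ -2` IS the long exact homology sequence of VII §3 ("`Ĥ⁻ⁿ(G, A) = H_{n-1}(G, A)` for `n ≥ 2`"):
the connecting map `H₁(G, C) → H₀(G, A)` sends the class of a `1`-cycle `z` of `C` to the class
of `a ∈ A` with `f(a) = ∂b` for any `1`-chain `b` of `B` lifting `z` — followed here by
`H₀(G, A) ⊇ _N A/IA = Ĥ⁻¹(G, A)` (automatically `N a = 0`, since `N ∘ ∂ = 0`).  K. S. Brown,
*Cohomology of Groups* (1982), VI §5 (5.1) (the long exact sequence of Tate cohomology)
[Brown1982CohomologyGroups].  Mathlib: `TateCohomology.δ hX (-2)` is the connecting map of the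
short exact sequence of Tate complexes; in degrees `-2 → -1` the Tate complex is the inhomogeneous
chains `C₁(G, M) --∂--> C₀(G, M)` (`tateComplex_d_neg`), with Mathlib's convention
`∂(m·(g)) = g⁻¹m - m` (`groupHomology.d₁₀_single`).

## What is formalised (`k` a commutative ring, `G` a finite group, `0 → A → B → C → 0` short exact
in `Rep k G`)

* `Tate.exists_d₁₀_lift`: for a `1`-cycle `z` of `C` and a `1`-chain `b` of `B` with `g ∘ b = z`
  there is `a ∈ A` with `N a = 0` and `f a = ∂ b`;
* **`Tate.δ_negTwoClass`: `TateCohomology.δ hX (-2) (negTwoClass C z) = negOneClass A a`** for any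
  such `b`, `a`; `tateCohomologyNegOneIso_hom_δ_negTwoClass` (read in `_N A / IA`: `δ[z] ↦ a mod
  IA`); `exists_δ_negTwoClass_eq` (existential packaging).

## References
* J.-P. Serre, *Local Fields*, GTM 67, Springer (1979), VIII §1; VII §3. [Serre1979]
* K. S. Brown, *Cohomology of Groups*, GTM 87, Springer (1982), VI §5 (5.1). [Brown1982CohomologyGroups]
-/

noncomputable section

open CategoryTheory CategoryTheory.Limits groupCohomology groupHomology Finsupp

universe u

namespace Literature.Algebra.Homology

namespace Tate

section Delta

variable {k G : Type u} [CommRing k] [Group G] [Fintype G] {X : ShortComplex (Rep.{u} k G)}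
  (hX : X.ShortExact)

/-- `N ∘ ∂ = 0` on `1`-chains (`N(g⁻¹m - m) = 0`). [cite: Serre1979, VIII §1 ("`IA ⊂ Ker N`")] -/
theorem norm_d₁₀ (M : Rep.{u} k G) (y : G →₀ M.V) : M.ρ.norm (d₁₀ M y) = 0 := by
  have h0 : (d₁₀ M ≫ M.norm.toModuleCatHom) y = 0 := by
    rw [Rep.comp_eq_zero]
    rfl
  rwa [ModuleCat.comp_apply] at h0

omit [Fintype G] in
/-- `∂` commutes with morphisms: `φ (∂ y) = ∂ (φ ∘ y)` (`∂(m·(g)) = g⁻¹m - m`). [cite: Serre1979, VII §3] -/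
theorem hom_d₁₀ {A B : Rep.{u} k G} (φ : A ⟶ B) (y : G →₀ A.V) :
    φ.hom (d₁₀ A y) = d₁₀ B (mapRange.linearMap φ.hom.toLinearMap y) := by
  refine Finsupp.induction_linear y (by simp) (fun f g hf hg => by simp only [map_add, hf, hg])
    fun g a => ?_
  rw [mapRange.linearMap_apply, mapRange_single, d₁₀_single, d₁₀_single, map_sub,
    Rep.hom_comm_apply]
  rfl

include hX in
/-- For a `1`-cycle `z` of `C` and a `1`-chain `b` of `B` over it, `∂b` lies in `A`: there is `a ∈ A`
with `f a = ∂ b`, and `N a = 0` (`f (N a) = N (∂ b) = 0`, `f` injective).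
[cite: Serre1979, VII §3; VIII §1] -/
theorem exists_d₁₀_lift (z : cycles₁ X.X₃) (b : G →₀ X.X₂.V)
    (hb : mapRange.linearMap X.g.hom.toLinearMap b = z.1) :
    ∃ a : LinearMap.ker X.X₁.ρ.norm, X.f.hom (a : X.X₁.V) = d₁₀ X.X₂ b := by
  have hrange : LinearMap.range X.f.hom.toLinearMap = LinearMap.ker X.g.hom.toLinearMap :=
    (hX.exact.map (forget₂ (Rep k G) (ModuleCat k))).moduleCat_range_eq_ker
  have hdb : X.g.hom (d₁₀ X.X₂ b) = 0 := by
    rw [hom_d₁₀, hb]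
    exact LinearMap.mem_ker.1 z.2
  have hmem : d₁₀ X.X₂ b ∈ LinearMap.range X.f.hom.toLinearMap := by
    rw [hrange]
    exact hdb
  obtain ⟨a, ha⟩ := hmem
  have hinj : Function.Injective X.f.hom := (Rep.mono_iff_injective X.f).1 hX.mono_f
  refine ⟨⟨a, LinearMap.mem_ker.2 (hinj ?_)⟩, ha⟩
  have h : X.f.hom (X.X₁.ρ.norm a) = X.X₂.ρ.norm (X.f.hom a) := by
    simp only [Representation.norm, LinearMap.coe_sum, Finset.sum_apply, map_sum]
    exact Finset.sum_congr rfl fun g _ => Rep.hom_comm_apply X.f g a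
  rw [h, map_zero, show X.f.hom a = d₁₀ X.X₂ b from ha]
  exact norm_d₁₀ X.X₂ b

/-- **Serre VIII §1 / VII §3, Brown VI (5.1): the connecting map `δ : Ĥ⁻²(G, C) → Ĥ⁻¹(G, A)` on
classes** — for a `1`-cycle `z` of `C`, a `1`-chain `b` of `B` with `g ∘ b = z` and `a ∈ A` (`N a = 0`)
with `f a = ∂ b`, Mathlib's `TateCohomology.δ` sends `[z] ∈ Ĥ⁻²(G, C)` to `[a] ∈ Ĥ⁻¹(G, A)`.
[cite: Serre1979, VIII §1; VII §3][cite: Brown1982CohomologyGroups, VI §5 (5.1)] -/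
theorem δ_negTwoClass (z : cycles₁ X.X₃) (b : G →₀ X.X₂.V)
    (hb : mapRange.linearMap X.g.hom.toLinearMap b = z.1) (a : LinearMap.ker X.X₁.ρ.norm)
    (ha : X.f.hom (a : X.X₁.V) = d₁₀ X.X₂ b) :
    TateCohomology.δ hX (-2) (negTwoClass X.X₃ z) = negOneClass X.X₁ a := by
  have hS := TateCohomology.map_tateComplexFunctor_shortExact hX
  -- the three hypotheses of the element-level snake lemma `ShortExact.δ_apply`
  have hx₃ : ((forget₂ (ModuleCat k) Ab).map ((X.map (tateComplexFunctor k G)).X₃.d (-2) (-2 + 1)))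
      (chain₁ X.X₃ z.1) = 0 :=
    tateComplex_d_chain₁ X.X₃ z
  have hx₂ : ((forget₂ (ModuleCat k) Ab).map ((X.map (tateComplexFunctor k G)).g.f (-2)))
      (chain₁ X.X₂ b) = chain₁ X.X₃ z.1 := by
    change (chainsMap (MonoidHom.id G) X.g).f 1 ((chainsIso₁ X.X₂).inv b) =
      (chainsIso₁ X.X₃).inv z.1
    apply (ModuleCat.mono_iff_injective (chainsIso₁ X.X₃).hom).1 inferInstance
    rw [← ModuleCat.comp_apply, chainsMap_f_1_comp_chainsIso₁, ModuleCat.comp_apply,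
      ← ModuleCat.comp_apply ((chainsIso₁ X.X₂).inv), Iso.inv_hom_id, ModuleCat.id_apply,
      ← ModuleCat.comp_apply, Iso.inv_hom_id, ModuleCat.id_apply]
    simpa [ModuleCat.hom_ofHom, lmapDomain_apply, Finsupp.mapDomain_id] using hb
  have hx₁ : ((forget₂ (ModuleCat k) Ab).map ((X.map (tateComplexFunctor k G)).f.f (-2 + 1)))
      (chain₀ X.X₁ (a : X.X₁.V)) =
      ((forget₂ (ModuleCat k) Ab).map ((X.map (tateComplexFunctor k G)).X₂.d (-2) (-2 + 1)))
        (chain₁ X.X₂ b) := by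
    change (chainsMap (MonoidHom.id G) X.f).f 0 ((chainsIso₀ X.X₁).inv (a : X.X₁.V)) =
      ((chainsIso₁ X.X₂).inv ≫ (inhomogeneousChains X.X₂).d 1 0) b
    rw [eq_d₁₀_comp_inv, ModuleCat.comp_apply]
    apply (ModuleCat.mono_iff_injective (chainsIso₀ X.X₂).hom).1 inferInstance
    rw [← ModuleCat.comp_apply, chainsMap_f_0_comp_chainsIso₀, ModuleCat.comp_apply,
      ← ModuleCat.comp_apply ((chainsIso₀ X.X₁).inv), Iso.inv_hom_id, ModuleCat.id_apply,
      ← ModuleCat.comp_apply ((chainsIso₀ X.X₂).inv), Iso.inv_hom_id, ModuleCat.id_apply]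
    exact ha
  have key := hS.δ_apply (-2) (-2 + 1) rfl (chain₁ X.X₃ z.1) hx₃ (chain₁ X.X₂ b) hx₂
    (chain₀ X.X₁ (a : X.X₁.V)) hx₁ 0 (by simp)
  -- identify the two cycles with `cycles₁ToCycles z` and `kerNormToCycles a`
  have h₃ : (X.map (tateComplexFunctor k G)).X₃.cyclesMk (i := -2) (chain₁ X.X₃ z.1) (-2 + 1)
      ((ComplexShape.up ℤ).next_eq' rfl) hx₃ = cycles₁ToCycles X.X₃ z := by
    apply (ModuleCat.mono_iff_injective ((tateComplex X.X₃).iCycles (-2))).1 inferInstance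
    have h1 := (X.map (tateComplexFunctor k G)).X₃.i_cyclesMk (i := -2) (chain₁ X.X₃ z.1)
      (-2 + 1) ((ComplexShape.up ℤ).next_eq' rfl) hx₃
    exact h1.trans (iCycles_cycles₁ToCycles X.X₃ z).symm
  have h₁ : ∀ hx, (X.map (tateComplexFunctor k G)).X₁.cyclesMk (i := -2 + 1)
      (chain₀ X.X₁ (a : X.X₁.V)) 0 (by simp) hx = kerNormToCycles X.X₁ a := fun hx => by
    apply (ModuleCat.mono_iff_injective ((tateComplex X.X₁).iCycles (-1))).1 inferInstance
    have h1 := (X.map (tateComplexFunctor k G)).X₁.i_cyclesMk (i := -2 + 1)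
      (chain₀ X.X₁ (a : X.X₁.V)) 0 (by simp) hx
    have h2 : ((tateComplex X.X₁).iCycles (-1)) (kerNormToCycles X.X₁ a) =
        chain₀ X.X₁ (a : X.X₁.V) := by
      rw [← ModuleCat.comp_apply, kerNormToCycles_i]
      rfl
    exact h1.trans h2.symm
  rw [h₃, h₁] at key
  exact key

/-- The same statement read through the junction isomorphism `Ĥ⁻¹(G, A) ≅ _N A/IA ⊆ A_G`:
`δ[z] ↦ a mod IA`. [cite: Serre1979, VIII §1; VII §3][cite: Brown1982CohomologyGroups, VI §5 (5.1)] -/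
theorem tateCohomologyNegOneIso_hom_δ_negTwoClass (z : cycles₁ X.X₃) (b : G →₀ X.X₂.V)
    (hb : mapRange.linearMap X.g.hom.toLinearMap b = z.1) (a : LinearMap.ker X.X₁.ρ.norm)
    (ha : X.f.hom (a : X.X₁.V) = d₁₀ X.X₂ b) :
    (tateCohomologyNegOneIso X.X₁).hom (TateCohomology.δ hX (-2) (negTwoClass X.X₃ z)) =
      kerNormMk X.X₁ a := by
  rw [δ_negTwoClass hX z b hb a ha, tateCohomologyNegOneIso_hom_negOneClass]

/-- **`δ : Ĥ⁻²(G, C) → Ĥ⁻¹(G, A)` on classes, existential packaging**: every `1`-cycle `z` of `C`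
has a lift `b` and an `a ∈ A` (`N a = 0`) with `f a = ∂ b`, and `δ[z] = [a]`.
[cite: Serre1979, VIII §1; VII §3][cite: Brown1982CohomologyGroups, VI §5 (5.1)] -/
theorem exists_δ_negTwoClass_eq (z : cycles₁ X.X₃) :
    ∃ (b : G →₀ X.X₂.V) (a : LinearMap.ker X.X₁.ρ.norm),
      mapRange.linearMap X.g.hom.toLinearMap b = z.1 ∧ X.f.hom (a : X.X₁.V) = d₁₀ X.X₂ b ∧
      TateCohomology.δ hX (-2) (negTwoClass X.X₃ z) = negOneClass X.X₁ a := by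
  have hsurj : Function.Surjective X.g.hom.toLinearMap := (Rep.epi_iff_surjective X.g).1 hX.epi_g
  obtain ⟨b, hb⟩ := Finsupp.mapRange_surjective X.g.hom.toLinearMap (map_zero _) hsurj z.1
  obtain ⟨a, ha⟩ := exists_d₁₀_lift hX z b hb
  exact ⟨b, a, hb, ha, δ_negTwoClass hX z b hb a ha⟩

end Delta

end Tate

end Literature.Algebra.Homology
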